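import Mathlib
import Summits.Ventures.HodgeRepro2.Tier7.Line3.FinKappaOfLocalData
import Summits.Ventures.HodgeRepro2.Tier7.Line3.AdicValuationInvariantPrimesOver
import Summits.Ventures.HodgeRepro2.Tier7.Line3.LevelKappaConversion
import Summits.Ventures.HodgeRepro2.Tier7.Line3.AdicCompletionSplit

/-!
# Tier7/Line3/LocalDataOfAdicCompletion — the all-places κ-side package on Mathlib's completions
(seat t7-x1, gen 5; FinKappaOfLocalData's `LocalData` built with every local-field field a THEOREM)

LINE 3 (t7-plan-3), version (ii). `LocalData` (FinKappaOfLocalData p688011) packages, for every finite place `w` of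
`K = E⁺`, the local torus-translate data of the κ-side over an abstract completion-type `Ew w` with an involution
`σw w`, an embedding `ψ w : E →+* Ew w` and an absolute value `abv w`, and proves `FinKappa` from them
(`LocalData.toFinKappa`); its four local-field fields `hψ / habv / hna / hσ` (at the non-split places) and the two
split clauses `hS_split / hout_split` were displayed. This module builds a `LocalData` on Mathlib's completions:

* the place datum: a choice `wE w` of a prime of `E` above `maximalIdeal w` for every `w` (`hlies`), with ONE prime above
  the non-split places (`hone : w ∉ Sp → ncard (primesOver …) = 1`) — `Ew w := (wE w).adicCompletion E`;
* `σw w := completionMap (wE w) σ _` at the non-split places (the valuation invariance of the Galois involution from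
  `hone`, AdicValuationInvariantPrimesOver p705758) and the identity at the split places (read by no clause);
  `ψ w := FinitePlace.embedding (wE w)`; `abv w := abvRoot (maximalIdeal w) (wE w) = ‖·‖^{1/(e f)}`
  (AdicCompletionRestriction p706703);
* the four local-field fields are THEOREMS: `hψ` (`embedding_apply_eq_completionMap`), `habv`
  (`finitePlace_eq_abvRoot` + `FinitePlace.mk_maximalIdeal`), `hna` (`isNonarchimedean_abvRoot`), `hσ`
  (`abvRoot_completionMap`); `q := qκ (maximalIdeal v₁) (wE v₁)` (LevelKappaConversion p713992), and the level clause
  `hsupp_cong` is taken in the `b`-side tower's shape (`‖(k − 1) i j‖ ≤ (q (wE v₁))⁻¹ ^ (N+1)`, Mathlib's norm) and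
  converted (`abvRoot_le_of_entry_le`);
* the split clauses come from L1-p5's `SplitLocal` (FinKappaOfLocalSplit p688742) on the SAME completion-type family
  `Ew wE` (AdicCompletionSplit.SplitLocal.ofAdicCompletion, shape (β): `ψ₁ w = FinitePlace.embedding (wE w)`,
  `abv w = normAbv`, `e f = 1` displayed at the split places): `hS_split := D.hS_split`, `hout_split := D.hout_split`;
* `toFinKappa_adic`: the resulting `FinKappa κF arith γ₀` — every finite clause of `FinKappa` from local torus-translate
  data AT MATHLIB'S COMPLETIONS, no displayed split clause, no displayed local-field clause.

WHAT THIS CHANGES IN THE [W] COLUMN: the κ-side «choice of `(E_w, ψ_w, abv_w)` above `w`» (KappaDataFinLocal's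
docstring; TYPING-CENSUS) is gone at EVERY finite place: `Ew w`, `ψ w`, `abv w`, `σw w` are Mathlib's objects, the
local-field clauses theorems; the κ-side `q` at `v₁` is `qκ`, read off the `b`-side tower. STILL IN WORDS: WHICH prime
`wE w` above each `w` is «the» place of the datum (a choice; at the non-split places it is unique), the splitting homs
`ψ₁ w` at the split places, the integrality / entry-bound / support clauses in the adapted coordinates (displayed,
as before), that the real `v₁` is not split and has one prime above it, the identification (a′). Nothing here is
about (N), (P), the real `X`, or HC_CM; §8(d): NO. Blind lane: Mathlib + the HodgeRepro2 prefix; no sorry;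
axioms ⊆ {propext, Classical.choice, Quot.sound}.
-/

namespace Summit.Ventures.HodgeRepro2.Tier7.Line3.LocalDataOfAdicCompletion

open IsDedekindDomain IsDedekindDomain.HeightOneSpectrum NumberField Matrix
  Summit.Ventures.HodgeRepro2.Tier7.Line3.LevelTowerTopology
  Summit.Ventures.HodgeRepro2.Tier7.Line3.AdicCompletionInvolution
  Summit.Ventures.HodgeRepro2.Tier7.Line3.AdicCompletionLevel
  Summit.Ventures.HodgeRepro2.Tier7.Line3.AdicCompletionRestriction
  Summit.Ventures.HodgeRepro2.Tier7.Line3.AdicValuationInvariant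
  Summit.Ventures.HodgeRepro2.Tier7.Line3.LevelKappaConversion
  Summit.Ventures.HodgeRepro2.Tier7.Line3.KappaDataFinLocal
  Summit.Ventures.HodgeRepro2.Tier7.Line3.KappaDataFinLocalSplit
  Summit.Ventures.HodgeRepro2.Tier7.Line3.KappaDataOfAdapted
  Summit.Ventures.HodgeRepro2.Tier7.Line3.AdicCompletionSplit
  Summit.Ventures.HodgeRepro2.T7SupportTwoTorusInvariant
open scoped NumberField Classical

variable {E K : Type} [Field E] [NumberField E] [Field K] [NumberField K] [Algebra K E]
  (σ : E ≃ₐ[K] E) (wE : FinitePlace K → HeightOneSpectrum (𝓞 E))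
  (hlies : ∀ w, (wE w).asIdeal.LiesOver (FinitePlace.maximalIdeal w).asIdeal)
  (Sp : Set (FinitePlace K))
  (hone : ∀ w, w ∉ Sp → (Ideal.primesOver (FinitePlace.maximalIdeal w).asIdeal (𝓞 E)).ncard = 1)

/-! ## The completion-types, the involution and the absolute value at every place -/

include hlies hone in
/-- **the valuation invariance of the Galois involution at a non-split place** (one prime above `w`). -/
theorem valuation_apply_eq (w : FinitePlace K) (hw : w ∉ Sp) (x : E) :
    (wE w).valuation E ((σ : E →+* E) x) = (wE w).valuation E x :=
  haveI := hlies w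
  valuation_galRestrict_of_ncard_eq_one (wE w) (FinitePlace.maximalIdeal w) σ (hone w hw) x

omit [NumberField E] in
include hlies hone in
/-- **the chosen prime above a non-split place is the only one**: every prime of `E` lying over `maximalIdeal w` is
`wE w` when `w ∉ Sp` (`hone`; AdicValuationInvariantPrimesOver.huniq_of_ncard_eq_one) — so the only CHOICE in the
place datum is the split-place prime («one of the two primes above `p`»; plan-3 STATUS l. 16201 (4)). -/
theorem wE_unique_of_not_mem (w : FinitePlace K) (hw : w ∉ Sp) (P : HeightOneSpectrum (𝓞 E))
    [P.asIdeal.LiesOver (FinitePlace.maximalIdeal w).asIdeal] : P = wE w :=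
  haveI := hlies w
  huniq_of_ncard_eq_one (wE w) (FinitePlace.maximalIdeal w) (hone w hw) P
    (comap_eq_of_liesOver P (FinitePlace.maximalIdeal w))

/-- **the local involution**: the extension of `σ` to the completion at a non-split place, the identity at a split
place (where no clause of `LocalData` reads it — its four local-field fields are guarded by `w ∉ Sp`). At `w ∉ Sp` the
branch depends on `hone w hw` through `valuation_apply_eq` (the valuation invariance of `σ` at the unique prime
above `w`; crit-2 STATUS l. 16200 (iii)); `σw_of_not_mem` exhibits the proof term. -/
noncomputable def σw (w : FinitePlace K) : Ew wE w →+* Ew wE w :=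
  if hw : w ∉ Sp then completionMap (wE w) (σ : E →+* E) (valuation_apply_eq σ wE hlies Sp hone w hw)
  else RingHom.id _

/-- at a non-split place `σw` is the extended involution. -/
theorem σw_of_not_mem (w : FinitePlace K) (hw : w ∉ Sp) :
    σw σ wE hlies Sp hone w = completionMap (wE w) (σ : E →+* E) (valuation_apply_eq σ wE hlies Sp hone w hw) := by
  unfold σw
  rw [dif_pos hw]

/-- **the κ-side absolute value** `‖·‖^{1/(e f)}` of the completion at `w`. -/
noncomputable def abv (w : FinitePlace K) : AbsoluteValue (Ew wE w) ℝ :=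
  haveI := hlies w
  abvRoot (FinitePlace.maximalIdeal w) (wE w)

/-- `abv` on the nose. -/
theorem abv_def (w : FinitePlace K) :
    abv wE hlies w = (haveI := hlies w; abvRoot (FinitePlace.maximalIdeal w) (wE w)) := rfl

/-! ## The four local-field fields as theorems -/

/-- `hψ`: the embedding intertwines `σ` and the local involution at a non-split place. -/
theorem hψ_adic (w : FinitePlace K) (hw : w ∉ Sp) (x : E) :
    FinitePlace.embedding (wE w) ((σ : E →+* E) x) = σw σ wE hlies Sp hone w (FinitePlace.embedding (wE w) x) := by
  rw [σw_of_not_mem σ wE hlies Sp hone w hw]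
  exact embedding_apply_eq_completionMap (wE w) (σ : E →+* E) _ x

/-- `habv`: `abv w` restricts to the place `w` of `K`. -/
theorem habv_adic (w : FinitePlace K) (x : K) :
    w x = abv wE hlies w (FinitePlace.embedding (wE w) (algebraMap K E x)) := by
  haveI := hlies w
  conv_lhs => rw [← FinitePlace.mk_maximalIdeal w]
  exact finitePlace_eq_abvRoot (FinitePlace.maximalIdeal w) (wE w) x

/-- `hna`: `abv w` is nonarchimedean. -/
theorem hna_adic (w : FinitePlace K) : IsNonarchimedean (abv wE hlies w) :=
  haveI := hlies w
  isNonarchimedean_abvRoot (FinitePlace.maximalIdeal w) (wE w)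

/-- `hσ`: `abv w` is invariant under the local involution at a non-split place. -/
theorem hσ_adic (w : FinitePlace K) (hw : w ∉ Sp) (x : Ew wE w) :
    abv wE hlies w (σw σ wE hlies Sp hone w x) = abv wE hlies w x := by
  haveI := hlies w
  rw [σw_of_not_mem σ wE hlies Sp hone w hw]
  exact abvRoot_completionMap (FinitePlace.maximalIdeal w) (wE w) (σ : E →+* E) _ x

/-! ## The `LocalData` on the completions -/

variable {Orb : Type} (d : Fin 2 → E) (f : Fin 2 → Fin 2 → E) (matO : Orb → Matrix (Fin 2) (Fin 2) E)
  (κF : Orb → K) (arith : ℕ → Orb → Prop) (γ₀ : Orb)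

/-- **`LocalData` on Mathlib's completions**: `Ew w := (wE w).adicCompletion E`, `ψ w := FinitePlace.embedding (wE w)`,
`σw` the extended involution, `abv w := abvRoot`, `q := qκ (maximalIdeal v₁) (wE v₁)`; the local-field fields
`hψ / habv / hna / hσ` are the theorems above; the split clauses come from a `SplitLocal` on the SAME family `Ew wE`
(AdicCompletionSplit, shape (β)); the level clause at `v₁` is taken in the `b`-side tower's shape and converted.
Every other field (the integrality / entry-bound / support clauses in the adapted coordinates — `hf_int`, `hd_int`,
`hdisc_unit`, `hγ₀_int`, `hsupp_int`, `hf_S`, `hd_S`, `hγ₀_S`, `hsupp_S`, `hdisc_S`, `hγ₀w`, `hγ₀w_int`, `hsupp_cong`'s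
translate clause — the real datum's clauses in the adapted coordinates at every place, in words) is passed through
DISPLAYED (crit-2 STATUS l. 16200 (iv)).
RECORDS (crit-2 l. 16200, plan-3 l. 16201): (1) NO `e = 1` IS USED — `hone` («one prime above `w`») admits the ramified
case; the file needs only `e f` through `abvRoot = ‖·‖^{1/(e f)}` (p706703); the inert datum `e = 1` is the `b`-side's
displayed datum (InertLevelBase p714738), consistent with `hone` for the real `v₁`, neither implying the other.
(2) TWO `q`s, ONE CONVERSION: `q := qκ` is the κ-side base `(q (wE v₁))^{1/(e f)}` of LevelKappaConversion (p713992);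
the `b`-side's `q (wE v₁) = N(v₁)^f` (InertLevelBase) stays the `b`-side's; `hsupp_cong` is taken at the `b`-side
radius `(q (wE v₁))⁻¹ ^ (N+1)` and converted by `abvRoot_le_of_entry_le` — the ONE drop of a power is p713992's
binder shape (census (h⁗⁸′)), cited once. (3) `hone` together with p715395's `hsplit : ∀ w ∈ Sp, localDeg … = 1` PINS
`Sp` to exactly the set of split places (a split place outside `Sp` has two primes above it; a non-split place inside
`Sp` has `e f = 2`) — the real `Sp`. (4) `σ : E ≃ₐ[K] E` here; `D`, `kappa`, `hκF` and the translate clauses read the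
SAME coerced `(σ : E →+* E)`, so the fields match by `rfl`. (5) NON-VACUITY of the place datum: `E = ℚ(i)`, `K = ℚ`,
`v₁ = (3)` inert with one prime above it, `Sp = {p ≡ 1 (mod 4)}` with `wE p` one of the two primes above `p`; the
κ-clauses are the real datum's, in words. -/
noncomputable def LocalData.ofAdicCompletion
    (hκF : ∀ γ, algebraMap K E (κF γ) = kappa (σ : E →+* E) d f (matO γ))
    (v₁ : FinitePlace K) (S : Finset (FinitePlace K)) (hv₁S : v₁ ∉ S) (hv₁Sp : v₁ ∉ Sp)
    (hf_int : ∀ w, w ∉ S → w ∉ Sp → ∀ i, abv wE hlies w (FinitePlace.embedding (wE w) (f 0 i)) ≤ 1)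
    (hd_int : ∀ w, w ∉ S → w ∉ Sp → abv wE hlies w (FinitePlace.embedding (wE w) (d 0)) ≤ 1)
    (hdisc_unit : ∀ w, w ∉ S → w ∉ Sp → abv wE hlies w (FinitePlace.embedding (wE w) (d 0) *
      disc' (σw σ wE hlies Sp hone w) (fun i => FinitePlace.embedding (wE w) (d i))
        (fun j i => FinitePlace.embedding (wE w) (f j i)) 0) = 1)
    (hγ₀_int : ∀ w, w ∉ S → w ∉ Sp → ∃ m₀, IsTranslate (σw σ wE hlies Sp hone w)
      (fun j i => FinitePlace.embedding (wE w) (f j i)) ((matO γ₀).map (FinitePlace.embedding (wE w))) m₀ ∧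
      ∀ i j, abv wE hlies w (m₀ i j) ≤ 1)
    (hsupp_int : ∀ w, w ∉ S → w ∉ Sp → w ≠ v₁ → ∀ N γ, arith N γ → ∃ m, IsTranslate (σw σ wE hlies Sp hone w)
      (fun j i => FinitePlace.embedding (wE w) (f j i)) ((matO γ).map (FinitePlace.embedding (wE w))) m ∧
      ∀ i j, abv wE hlies w (m i j) ≤ 1)
    (M : FinitePlace K → ℝ) (hM : ∀ w ∈ S, 0 < M w)
    (hf_S : ∀ w ∈ S, w ∉ Sp → ∀ i, abv wE hlies w (FinitePlace.embedding (wE w) (f 0 i)) ≤ M w)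
    (hd_S : ∀ w ∈ S, w ∉ Sp → abv wE hlies w (FinitePlace.embedding (wE w) (d 0)) ≤ M w)
    (hγ₀_S : ∀ w ∈ S, w ∉ Sp → ∃ m₀, IsTranslate (σw σ wE hlies Sp hone w)
      (fun j i => FinitePlace.embedding (wE w) (f j i)) ((matO γ₀).map (FinitePlace.embedding (wE w))) m₀ ∧
      ∀ i j, abv wE hlies w (m₀ i j) ≤ M w)
    (hsupp_S : ∀ w ∈ S, w ∉ Sp → ∀ N γ, arith N γ → ∃ m, IsTranslate (σw σ wE hlies Sp hone w)
      (fun j i => FinitePlace.embedding (wE w) (f j i)) ((matO γ).map (FinitePlace.embedding (wE w))) m ∧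
      ∀ i j, abv wE hlies w (m i j) ≤ M w)
    (hdisc_S : ∀ w ∈ S, w ∉ Sp → abv wE hlies w (FinitePlace.embedding (wE w) (d 0) *
      disc' (σw σ wE hlies Sp hone w) (fun i => FinitePlace.embedding (wE w) (d i))
        (fun j i => FinitePlace.embedding (wE w) (f j i)) 0) ≠ 0)
    (γ₀w : Matrix (Fin 2) (Fin 2) (Ew wE v₁))
    (hγ₀w : IsTranslate (σw σ wE hlies Sp hone v₁) (fun j i => FinitePlace.embedding (wE v₁) (f j i))
      ((matO γ₀).map (FinitePlace.embedding (wE v₁))) γ₀w)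
    (hγ₀w_int : ∀ i j, abv wE hlies v₁ (γ₀w i j) ≤ 1)
    (hsupp_cong : ∀ N γ, arith N γ → ∃ k : Matrix (Fin 2) (Fin 2) (Ew wE v₁),
      IsTranslate (σw σ wE hlies Sp hone v₁) (fun j i => FinitePlace.embedding (wE v₁) (f j i))
        ((matO γ).map (FinitePlace.embedding (wE v₁))) (γ₀w * k) ∧
      ∀ i j, ‖(k - 1) i j‖ ≤ (q (wE v₁))⁻¹ ^ (N + 1))
    (D : SplitLocal (Ew wE) (σ : E →+* E) d f matO κF arith γ₀ S Sp M) :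
    LocalData (Ew wE) (σ : E →+* E) d f matO κF arith γ₀ where
  hκF := hκF
  v₁ := v₁
  S := S
  hv₁S := hv₁S
  Sp := Sp
  hv₁Sp := hv₁Sp
  q := haveI := hlies v₁; qκ (FinitePlace.maximalIdeal v₁) (wE v₁)
  hq := haveI := hlies v₁; one_lt_qκ (FinitePlace.maximalIdeal v₁) (wE v₁)
  σw := σw σ wE hlies Sp hone
  ψ := fun w => FinitePlace.embedding (wE w)
  abv := abv wE hlies
  hψ := fun w hw x => hψ_adic σ wE hlies Sp hone w hw x
  habv := fun w _ x => habv_adic wE hlies w x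
  hna := fun w _ => hna_adic wE hlies w
  hσ := fun w hw x => hσ_adic σ wE hlies Sp hone w hw x
  hf_int := hf_int
  hd_int := hd_int
  hdisc_unit := hdisc_unit
  hγ₀_int := hγ₀_int
  hsupp_int := hsupp_int
  M := M
  hM := hM
  hf_S := hf_S
  hd_S := hd_S
  hγ₀_S := hγ₀_S
  hsupp_S := hsupp_S
  hdisc_S := hdisc_S
  γ₀w := γ₀w
  hγ₀w := hγ₀w
  hγ₀w_int := hγ₀w_int
  hsupp_cong := fun N γ hγ => by
    haveI := hlies v₁
    obtain ⟨k, hk, hkN⟩ := hsupp_cong N γ hγ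
    exact ⟨k, hk, abvRoot_le_of_entry_le (FinitePlace.maximalIdeal v₁) (wE v₁) N k hkN⟩
  hS_split := D.hS_split
  hout_split := D.hout_split

end Summit.Ventures.HodgeRepro2.Tier7.Line3.LocalDataOfAdicCompletion
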